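import Literature.AlgebraicGeometry.Modules.DeligneSheafHomAffine
import HarnessLib

/-!
# The Deligne homomorphism of a section over `X ∖ V(𝓘)`, II: the modules `𝓘ⁿ𝒪_X` and representing morphisms

Sequel of `Modules/DeligneSheafHomAffine` (Hartshorne III Ex. 3.7 (a) / II Ex. 5.15; EGA I 6.9.17).
For an open `W ⊆ X` with ideal sheaf `𝓘 = idealOfCompl W` of `X ∖ W`, the coherent submodules
`Eₙ = 𝓘ⁿ𝒪_X ⊆ 𝒪_X` (`powIdealModule W n`, the tree's `idealMul` of `Modules/IdealMul`) and, for an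
affine open `V`, the dictionary between morphisms `Eₙ|_V ⟶ M|_V` (restricted modules and `appLE` of
`Modules/SheafHom`, `evalHom`/`homOfLinear` of `Modules/SheafHomAffineSections`) and linear maps
`𝓘(V)ⁿ → Γ(V, M)`:

* `isAffineLocalizing_powIdealModule`, `coh_powIdealModule`;
* `secFun`, `secToIdeal` / `idealToSec` — **`Γ(V, 𝓘ⁿ𝒪_X) = 𝓘(V)ⁿ`** on an affine `V`
  (`isIdealMulSection_iff_of_isAffineOpen`);
* `RepresentsSec`, `RepresentsHom` — "`ψ(e)|_{V ∩ W} = e · s|_{V ∩ W}`" for linear maps on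
  `V`-sections / morphisms over `V`; `exists_representsHom` — **a representing `ψ : Eₙ|_V ⟶ M|_V`
  exists** (`M` affine-localizing, `Γ(V, 𝒪_X)` Noetherian);
* `powMono` (`Eₘ ⟶ Eₙ`, `n ≤ m`), `representsHom_powMono_comp` (raising the exponent),
  **`exists_forall_evalHom_eq_of_representsHom`** — two representing morphisms over `V` agree on the
  `V`-sections of `Eₙ₊c` for `c ≫ 0`;
* **`representsHom_restrictHom`** — a representing morphism over `V` restricts to a representing
  morphism over every `V′ ⊆ V` (numerators of `Eₙ` on principal opens, cancellation of units).

The global gluing is `Modules/DeligneSheafHomGlobal`. Everything is proved; no named facts.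

## References

* R. Hartshorne, *Algebraic Geometry*, GTM 52 (1977): II Ex. 5.15, III Ex. 3.7 (a). [Hartshorne1977]
* A. Grothendieck, J. Dieudonné, EGA I (Springer 1971), 6.9.17.
-/

noncomputable section

-- `TopCat.Presheaf`/`Scheme.Modules` are not reducible (as in Mathlib's `AlgebraicGeometry/Modules`).
set_option backward.isDefEq.respectTransparency false

open CategoryTheory AlgebraicGeometry Limits TopologicalSpace Opposite
open Literature.AlgebraicGeometry.Morphisms Literature.AlgebraicGeometry.Motives

universe u

namespace Literature.AlgebraicGeometry.Modules

variable {X : Scheme.{u}}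

/-- `𝓘ⁿ𝒪_X ⊆ 𝒪_X` for the ideal sheaf `𝓘` of `X ∖ W`. [folklore] -/
abbrev powIdealModule (W : X.Opens) (n : ℕ) : X.Modules :=
  idealMul (unitModule X) (idealOfCompl W ^ n)

/-- A section of `𝒪_X` over `V`, viewed as a function (the carrier of `Γ(V, 𝒪_X)` as a module
over itself is `Γ(X, V)`). [folklore] -/
abbrev unitToFun {V : X.Opens} (x : Γ(unitModule X, V)) : Γ(X, V) := x

/-- Restricting twice is restricting once (sections of `M`). [folklore] -/
private theorem mmap_mmap (M : X.Modules) {A B C : X.Opens} (h1 : B ≤ A) (h2 : C ≤ B) (m : Γ(M, A)) :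
    M.presheaf.map (homOfLE h2).op (M.presheaf.map (homOfLE h1).op m) =
      M.presheaf.map (homOfLE (h2.trans h1)).op m := by
  rw [map_map]
  exact map_eq_map M _ _ m

/-- Restricting twice is restricting once (functions). [folklore] -/
private theorem xmap_xmap {A B C : X.Opens} (h1 : B ≤ A) (h2 : C ≤ B) (r : Γ(X, A)) :
    X.presheaf.map (homOfLE h2).op (X.presheaf.map (homOfLE h1).op r) =
      X.presheaf.map (homOfLE (h2.trans h1)).op r := by
  rw [← CategoryTheory.comp_apply, ← Functor.map_comp]
  rfl

/-! ## The modules `Eₙ = 𝓘ⁿ𝒪_X` and representing morphisms `Eₙ|_V ⟶ M|_V` -/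

section ModuleSide

variable (W : X.Opens)

/-- `𝓘ⁿ𝒪_X` is affine-localizing (quasi-coherent). [cite: Hartshorne1977, II Prop. 5.9 (p. 116)] -/
theorem isAffineLocalizing_powIdealModule (n : ℕ) : IsAffineLocalizing (powIdealModule W n) :=
  isAffineLocalizing_idealMul IsAffineLocalizing.unit

/-- `𝓘ⁿ𝒪_X` is coherent (`X` locally Noetherian). [cite: Hartshorne1977, II Prop. 5.9 (p. 116)] -/
theorem coh_powIdealModule [IsLocallyNoetherian X] (n : ℕ) : Coh (powIdealModule W n) :=
  coh_idealMul _ ⟨IsAffineLocalizing.unit, IsAffineFiniteType.unit⟩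

variable {W} {V : X.Opens} (hV : IsAffineOpen V) (n : ℕ)

/-- The function underlying a section of `𝓘ⁿ𝒪_X`. [folklore] -/
abbrev secFun {U : X.Opens} (e : Γ(powIdealModule W n, U)) : Γ(X, U) :=
  unitToFun ((idealMulι (unitModule X) (idealOfCompl W ^ n)).app U e)

/-- `secFun` commutes with restriction. [cite: GortzWedhorn2020, Prop. 7.14 (p. 186)] -/
theorem secFun_map {U U' : X.Opens} (h : U' ≤ U) (e : Γ(powIdealModule W n, U)) :
    secFun n ((powIdealModule W n).presheaf.map (homOfLE h).op e) =
      X.presheaf.map (homOfLE h).op (secFun n e) := by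
  unfold secFun unitToFun
  rw [Scheme.Modules.Hom.app_map_apply]
  rfl

/-- `secFun` is `𝒪(U)`-linear. [cite: GortzWedhorn2020, Prop. 7.14 (p. 186)] -/
theorem secFun_smul {U : X.Opens} (r : Γ(X, U)) (e : Γ(powIdealModule W n, U)) :
    secFun n (r • e) = r * secFun n e := by
  unfold secFun unitToFun
  rw [Scheme.Modules.Hom.app_smul]
  rfl

/-- `secFun` is additive. [cite: GortzWedhorn2020, Prop. 7.14 (p. 186)] -/
theorem secFun_add {U : X.Opens} (e e' : Γ(powIdealModule W n, U)) :
    secFun n (e + e') = secFun n e + secFun n e' := by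
  unfold secFun unitToFun
  rw [map_add]

/-- Over an affine `V`, the function of a section of `𝓘ⁿ𝒪_X` lies in `𝓘(V)ⁿ`. [cite: GortzWedhorn2020, Prop. 7.14 (p. 186)] -/
theorem secFun_mem (e : Γ(powIdealModule W n, V)) : secFun n e ∈ idealAt W hV ^ n := by
  have h := idealMulι_app_mem (M := unitModule X) (J := idealOfCompl W ^ n)
    IsAffineLocalizing.unit hV e
  rw [Scheme.IdealSheafData.ideal_pow, Pi.pow_apply] at h
  -- `m ∈ I • ⊤` in `Γ(V, 𝒪_X)` viewed as a module over itself means `m ∈ I`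
  refine Submodule.smul_induction_on (p := fun m => unitToFun m ∈ idealAt W hV ^ n) h ?_ ?_
  · intro r hr m _
    exact Ideal.mul_mem_right (unitToFun m) _ hr
  · intro a b ha hb
    exact Ideal.add_mem _ ha hb

/-- **`Γ(V, 𝓘ⁿ𝒪_X) → 𝓘(V)ⁿ`** on an affine `V`. [folklore] -/
def secToIdeal : Γ(powIdealModule W n, V) →ₗ[Γ(X, V)] ↥(idealAt W hV ^ n) where
  toFun e := ⟨secFun n e, secFun_mem hV n e⟩
  map_add' e e' := Subtype.ext (secFun_add n e e')
  map_smul' r e := Subtype.ext (secFun_smul n r e)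

/-- The value of `secToIdeal`. [cite: GortzWedhorn2020, Prop. 7.14 (p. 186)] -/
@[simp]
theorem coe_secToIdeal (e : Γ(powIdealModule W n, V)) : (secToIdeal hV n e : Γ(X, V)) = secFun n e :=
  rfl

/-- An element of `𝓘(V)ⁿ` is a product section of `𝒪_X` over the affine `V`. [folklore] -/
private theorem isIdealMulSection_of_mem_pow {x : Γ(X, V)} (hx : x ∈ idealAt W hV ^ n) :
    IsIdealMulSection (unitModule X) (idealOfCompl W ^ n) V (show Γ(unitModule X, V) from x) := by
  refine isIdealMulSection_of_mem hV ?_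
  rw [Scheme.IdealSheafData.ideal_pow, Pi.pow_apply]
  have : (show Γ(unitModule X, V) from x) = x • (show Γ(unitModule X, V) from (1 : Γ(X, V))) :=
    (mul_one x).symm
  rw [this]
  exact Submodule.smul_mem_smul hx Submodule.mem_top

/-- **`𝓘(V)ⁿ → Γ(V, 𝓘ⁿ𝒪_X)`** on an affine `V` (inverse to `secToIdeal`). [folklore] -/
def idealToSec : ↥(idealAt W hV ^ n) →ₗ[Γ(X, V)] Γ(powIdealModule W n, V) where
  toFun x := (⟨(show Γ(unitModule X, V) from (x : Γ(X, V))), isIdealMulSection_of_mem_pow hV n x.2⟩ :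
    idealMulSubmoduleObj (unitModule X) (idealOfCompl W ^ n) V)
  map_add' _ _ := Subtype.ext rfl
  map_smul' _ _ := Subtype.ext rfl

/-- `secFun (idealToSec x) = x`. [folklore] -/
@[simp]
private theorem secFun_idealToSec (x : ↥(idealAt W hV ^ n)) : secFun n (idealToSec hV n x) = x := rfl

/-- `secToIdeal ∘ idealToSec = id`. [folklore] -/
@[simp]
private theorem secToIdeal_idealToSec (x : ↥(idealAt W hV ^ n)) : secToIdeal hV n (idealToSec hV n x) = x :=
  Subtype.ext rfl

/-- `idealToSec ∘ secToIdeal = id`. [folklore] -/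
@[simp]
private theorem idealToSec_secToIdeal (e : Γ(powIdealModule W n, V)) : idealToSec hV n (secToIdeal hV n e) = e :=
  idealMulι_app_injective _ _ _ rfl

variable {M : X.Modules} (s : Γ(M, W))

/-- **A linear map `ℓ : Γ(V, 𝓘ⁿ𝒪_X) → Γ(V, M)` represents `s`**: `ℓ(e)|_{V ∩ W} = e · s|_{V ∩ W}`.
[cite: Hartshorne1977, III Ex. 3.7 (a)] -/
def RepresentsSec (ℓ : Γ(powIdealModule W n, V) →ₗ[Γ(X, V)] Γ(M, V)) : Prop :=
  ∀ e : Γ(powIdealModule W n, V),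
    M.presheaf.map (homOfLE (inf_le_left : V ⊓ W ≤ V)).op (ℓ e) =
      X.presheaf.map (homOfLE (inf_le_left : V ⊓ W ≤ V)).op (secFun n e) •
        M.presheaf.map (homOfLE (inf_le_right : V ⊓ W ≤ W)).op s

/-- **A morphism `ψ : 𝓘ⁿ𝒪_X|_V ⟶ M|_V` represents `s`** if its evaluation on `V`-sections does.
[cite: Hartshorne1977, III Ex. 3.7 (a)] -/
def RepresentsHom (ψ : (powIdealModule W n).over V ⟶ M.over V) : Prop :=
  RepresentsSec n s (evalHom (powIdealModule W n) M V ψ)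

variable {n s hV}

/-- `Represents (ℓ ∘ idealToSec)` gives `RepresentsSec ℓ`. [folklore] -/
private theorem representsSec_of_represents (hV : IsAffineOpen V)
    {ℓ : Γ(powIdealModule W n, V) →ₗ[Γ(X, V)] Γ(M, V)}
    (h : Represents W s hV n (ℓ ∘ₗ idealToSec hV n)) : RepresentsSec n s ℓ := by
  intro e
  have := h (secToIdeal hV n e)
  rw [LinearMap.comp_apply, idealToSec_secToIdeal] at this
  exact this

/-- `RepresentsSec ℓ` gives `Represents (ℓ ∘ idealToSec)`. [folklore] -/
private theorem represents_of_representsSec (hV : IsAffineOpen V)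
    {ℓ : Γ(powIdealModule W n, V) →ₗ[Γ(X, V)] Γ(M, V)}
    (h : RepresentsSec n s ℓ) : Represents W s hV n (ℓ ∘ₗ idealToSec hV n) := fun x => by
  rw [LinearMap.comp_apply, h (idealToSec hV n x), secFun_idealToSec]

variable (s hV) in
include hV in
/-- **Existence of a representing morphism over an affine `V`** (`M` affine-localizing,
`Γ(V, 𝒪_X)` Noetherian). [cite: Hartshorne1977, III Ex. 3.7 (a)] -/
theorem exists_representsHom (hM : IsAffineLocalizing M) [IsNoetherianRing Γ(X, V)] :
    ∃ (n : ℕ) (ψ : (powIdealModule W n).over V ⟶ M.over V), RepresentsHom n s ψ := by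
  obtain ⟨n, Φ, hΦ⟩ := exists_linearMap_represents W s hV hM
  refine ⟨n, homOfLinear (isAffineLocalizing_powIdealModule W n) hV (Φ ∘ₗ secToIdeal hV n), ?_⟩
  unfold RepresentsHom
  rw [evalHom_homOfLinear]
  refine representsSec_of_represents hV ?_
  intro x
  rw [LinearMap.comp_apply, LinearMap.comp_apply, secToIdeal_idealToSec]
  exact hΦ x

/-- The inclusion `𝓘ᵐ𝒪_X ⟶ 𝓘ⁿ𝒪_X` for `n ≤ m`. [folklore] -/
def powMono {n m : ℕ} (h : n ≤ m) : powIdealModule W m ⟶ powIdealModule W n :=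
  idealMulMono (unitModule X) (by
    intro U
    rw [Scheme.IdealSheafData.ideal_pow, Scheme.IdealSheafData.ideal_pow, Pi.pow_apply, Pi.pow_apply]
    exact Ideal.pow_le_pow_right h)

/-- `powMono` preserves the underlying functions. [folklore] -/
@[simp]
private theorem secFun_powMono_app {n m : ℕ} (h : n ≤ m) {U : X.Opens} (e : Γ(powIdealModule W m, U)) :
    secFun n ((powMono (W := W) h).app U e) = secFun m e := rfl

/-- Evaluation of `f|_V ≫ ψ` on `V`-sections. [folklore] -/
private theorem evalHom_over_comp {E E' : X.Modules} (f : E' ⟶ E) (ψ : E.over V ⟶ M.over V) (e : Γ(E', V)) :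
    evalHom E' M V (SheafOfModules.Hom.over f V ≫ ψ) e = evalHom E M V ψ (f.app V e) := rfl

/-- **Raising the exponent**: `powMono|_V ≫ ψ` represents `s` if `ψ` does (compatibility of the maps `Hom(𝓘ⁿ, M) → Hom(𝓘ᵐ, M) → Γ(W, M)`). [cite: Hartshorne1977, III Ex. 3.7 (a)] -/
theorem representsHom_powMono_comp {n m : ℕ} (h : n ≤ m) {ψ : (powIdealModule W n).over V ⟶ M.over V}
    (hψ : RepresentsHom n s ψ) :
    RepresentsHom m s (SheafOfModules.Hom.over (powMono (W := W) h) V ≫ ψ) := by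
  intro e
  rw [evalHom_over_comp, hψ, secFun_powMono_app]

/-- **Agreement of two representing morphisms over an affine `V`** after raising the exponent:
`ψ`, `ψ'` representing `s` on `𝓘ⁿ𝒪_X|_V` agree on the `V`-sections of `𝓘ⁿ⁺ᶜ𝒪_X` for some `c`
(`M` affine-localizing, `Γ(V, 𝒪_X)` Noetherian). [cite: Hartshorne1977, III Ex. 3.7 (a)] -/
theorem exists_forall_evalHom_eq_of_representsHom (hV : IsAffineOpen V) (hM : IsAffineLocalizing M) [IsNoetherianRing Γ(X, V)]
    {n : ℕ} {ψ ψ' : (powIdealModule W n).over V ⟶ M.over V} (hψ : RepresentsHom n s ψ)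
    (hψ' : RepresentsHom n s ψ') :
    ∃ c : ℕ, ∀ e : Γ(powIdealModule W (n + c), V),
      evalHom _ M V ψ ((powMono (W := W) (Nat.le_add_right n c)).app V e) =
        evalHom _ M V ψ' ((powMono (W := W) (Nat.le_add_right n c)).app V e) := by
  obtain ⟨c, hc⟩ := exists_forall_eq_of_represents hM (represents_of_representsSec hV hψ)
    (represents_of_representsSec hV hψ')
  refine ⟨c, fun e => ?_⟩
  have hx : secFun (n + c) e ∈ idealAt W hV ^ (n + c) := secFun_mem hV (n + c) e
  have he : (powMono (W := W) (Nat.le_add_right n c)).app V e =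
      idealToSec hV n ⟨secFun (n + c) e, Ideal.pow_le_pow_right (Nat.le_add_right n c) hx⟩ :=
    idealMulι_app_injective _ _ _ rfl
  have h := hc (secFun (n + c) e) hx
  rw [LinearMap.comp_apply, LinearMap.comp_apply] at h
  rw [he]
  exact h

/-- **Descent of representation to affine sub-opens**: if `ψ : 𝓘ⁿ𝒪_X|_V ⟶ M|_V` represents `s`
on the affine `V`, its restriction to an affine `V' ⊆ V` represents `s` on `V'` (numerators of
`𝓘ⁿ𝒪_X` on the principal opens `D(r) ⊆ V'` of `V`, which cover `V'`, and cancellation of the unit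
`r` on `D(r)`). [cite: Hartshorne1977, III Ex. 3.7 (a)] -/
theorem representsHom_restrictHom (hV : IsAffineOpen V) {V' : X.Opens} (i : V' ⟶ V)
    {ψ : (powIdealModule W n).over V ⟶ M.over V} (hψ : RepresentsHom n s ψ) :
    RepresentsHom n s (restrictHom i ψ) := by
  intro y
  rw [evalHom_restrictHom_apply]
  rw [← sub_eq_zero]
  refine section_eq_zero_of_locally M _ fun p hp => ?_
  obtain ⟨r, hrV', hpr⟩ := hV.exists_basicOpen_le ⟨p, hp.1⟩ (i.le hp.1)
  have hY : X.basicOpen r ⊓ W ≤ V' ⊓ W := inf_le_inf_right W hrV'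
  refine ⟨X.basicOpen r ⊓ W, hY, ⟨hpr, hp.2⟩, ?_⟩
  rw [map_sub, sub_eq_zero, mmap_mmap, Scheme.Modules.map_smul, mmap_mmap, xmap_xmap]
  -- numerator of `y|_{D(r)}` for the affine-localizing `𝓘ⁿ𝒪_X` on `V`
  obtain ⟨N, x, hx⟩ := (isAffineLocalizing_powIdealModule W n).numerator hV r rfl
    ((powIdealModule W n).presheaf.map (homOfLE hrV').op y)
  have hYr : X.basicOpen r ⊓ W ≤ X.basicOpen r := inf_le_left
  have hrV : X.basicOpen r ≤ V := X.basicOpen_le r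
  -- (1) `r^N • (ψ y)|_{D(r)} = (ψ_V x)|_{D(r)}`
  have h1 : X.presheaf.map (homOfLE hrV).op r ^ N • M.presheaf.map (homOfLE hrV').op (appLE ψ i y) =
      M.presheaf.map (homOfLE hrV).op (evalHom (powIdealModule W n) M V ψ x) := by
    rw [evalHom_apply, ← appLE_map ψ (𝟙 V) (homOfLE hrV) x, hx, appLE_smul_right,
      ← appLE_map ψ i (homOfLE hrV') y]
    congr 1
  -- (2) the functions: `x|_{D(r)} = r^N · y|_{D(r)}`
  have h2 : X.presheaf.map (homOfLE hrV).op (secFun n x) =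
      X.presheaf.map (homOfLE hrV).op r ^ N * X.presheaf.map (homOfLE hrV').op (secFun n y) := by
    have := congrArg (secFun n) hx
    rwa [secFun_map, secFun_smul, secFun_map] at this
  -- (3) restrict (1) to `D(r) ∩ W` and use that `ψ` represents `s` on `V`
  apply pow_smul_injective M r hYr N
  dsimp only
  have h3 := congrArg (M.presheaf.map (homOfLE hYr).op) h1
  rw [Scheme.Modules.map_smul, map_pow, mmap_mmap, xmap_xmap, mmap_mmap,
    ← mmap_mmap M (inf_le_left : V ⊓ W ≤ V) (le_inf (hYr.trans hrV) inf_le_right), hψ x,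
    Scheme.Modules.map_smul, mmap_mmap, xmap_xmap,
    ← xmap_xmap hrV hYr (secFun n x), h2, map_mul, map_pow, xmap_xmap, xmap_xmap] at h3
  rw [h3, mul_smul]

end ModuleSide

end Literature.AlgebraicGeometry.Modules

end
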